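import Summits.QuantumFields.YangMills.Theorems.BalabanUVNodesN18HLayerW1InductionTerms
import Summits.QuantumFields.YangMills.Theorems.BalabanUVNodesN18HLayerW1RecursionTerms
import Summits.QuantumFields.YangMills.Theorems.BalabanUVNodesN22W1StripNumeralsAnyM
import Summits.QuantumFields.BalabanUV.T4Continuum.Spine.NE5.TwoRunTorusNE5All8

/-!
# BalabanUVNodes ∕ N18 — THE NUMERALS OF THE (STEP-T) ∕ (GEN-T) CHAIN, A3 RIDER: the STRICT [KP86] clause at the tree's witness, the whole numeric
# hypothesis tuple of files 16 ∕ 18 at EVERY bond-cube side `M`, and at EVERY block size `L ≥ 8` (Track A, DAG node N18 = NE5 `T4OutputRate.NE5 EA EB W κ θ C₅`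
# :211; cluster K4 «SpineRates»; file 19 of seat pub-ymgap-dag-n18-c, row s1, generation 5)

Cell `pub-ymgap`, HUMAN RULING D-0062 (Track A), R134 ACCELERATION seat `pub-ymgap-dag-n18-c` (strategy s1), generation 5.  THEOREMS ONLY (no `def`, no
`instance`, no `sorry`); imports files 16 `…N18HLayerW1InductionTerms` and 18 `…N18HLayerW1RecursionTerms` (the consumers, for §5), dag-n22-c's module 17′ `…N22W1StripNumeralsAnyM` (`YMDAG.N22.W1.lemma3Numerics_consts_anyM`, `…stripNumerics_consts`: the socket
bundle `Lemma3Numerics consts M (½L) (aw + 40M) 1 1 ½ 1` at every `M` and the non-strict clauses at the witness) and the NE5 cell's T52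
`Spine.NE5.TwoRunTorusNE5All8` (`lemma3_witness_all8`: the 41 printed ∕ located numeric conjuncts of [II] pp. 17–21 for EVERY `L ≥ 8` and EVERY `M ≥ 1`) BY NAME,
restates nothing of them.  `--supports` K3′ (helper).

WHY.  Files 10 ∕ 12 ∕ 15–18 of this seat (`…N18HLayerW1ConfigRecord`, `…Lemma3Config`, `…Induction(Terms)`, `…Recursion(Terms)`) read, besides the socket bundle
`hN : Lemma3Numerics c M (½c.L) a a₂ a₂′ a₅ Aabs` (`M` = the domain system's bond-cube side, at the record `θ.τ9.M`), the located rate clause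
`hrate : r₁ + 2·64·log 162 + 2 ≤ (1−8δ)·½L·κ`, the renewal `hrenew : e·9·64·K₀(64,8)²·C₃ε₁ ≤ E₀` and — because the table of record is NOT open (file 11
`…N18HLayerW1SpaceNotOpen`), so that file 10's any-table producer reads (2.38) on an open neighbourhood of the table with an amplitude `A′` just ABOVE `A`
(`le_of_forall_gt_amplitude`) — the STRICT clause `hsmall : C₃ε₁·e^{5r₁+1}·K₀(64,8)·9·64 < 1` (room for some `A′ > A` under the non-strict [KP86] clause).
The tree's witnesses export the NON-strict `… ≤ 1` (conjunct 31 of `B13Lemma3TorusNonvacuity.numerics_nonvacuous_pos_consts`; dag-n22-c's strip modules and N10's family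
read that one).  At the witness the product is in fact `α₆w·e^{−5μw}∕(Aup·A₂w) ≤ α₆w = (e·K₀(64,8)·64)⁻¹ < 1`; this file exports the strict inequality (§1, re-derived
from the PUBLIC definitions `ε₁t`, `ε₂w`, `α₆w`, `Aup`, `A₁w`, `A₂w`, `κw`, `μw` and `B13.Consts.C3act_mul_eps1` ∕ `eps2_printed` — the witness files keep their
arithmetic `private`), and packages the chain's numeric hypothesis tuple ONCE: at the witness for every `M` (§2–§3), and at every block size `L ≥ 8` — print's `L` is
*"an odd, positive integer > 11"* ([I] p. 251) — for every `M ≥ 1` (§4, where strictness is read for every `r₁ < κ` from the exported `≤ 1` by `e^{5(r₁−κ)} < 1`).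

WHAT (theorems only).
* §1 `one_le_Kw` (`1 ≤ K₀(64,8) = 162⁶⁴∕81`), `eps2_consts_eq` (`consts.eps2 = ε₂w`), `C3eps_consts_eq` (`consts.C3act·consts.ε₁ = 2·10⁴·A₁w·ε₂w`),
  `smallKP_consts_eq` (`C₃ε₁·e^{5κ+1}·K₀·9·64 = α₆w·e^{−5μw}∕(Aup·A₂w)` at the witness), `alpha6w_lt_one`, ★ `smallKP_consts_strict`.
* §2 ★ `chainNumerals_consts_anyM (M)` — the tuple `8 ≤ c.L`, `c.L = 8`, `Lemma3Numerics c M (½c.L) (aw + 40M) 1 1 ½ 1`, `0 ≤ κ`, `0 ≤ C₃ε₁`, `hrate` at `r₁ := κ`,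
  STRICT `hsmall` at `r₁ := κ`, `hrenew` at `E₀ := c.E₀`, `0 < c.E₀`, at `c := consts`, every `M : ℕ`.
* §3 `chainNumerals_nonvacuous_anyM (M)` — the `∃`-packaging in the binder order of files 16 ∕ 18 (`c, L, a, a₂, a₂′, a₅, Aabs, E₀, r₁`), `r₁ = c.κ`, `E₀ = c.E₀` displayed.
* §4 `strictKP_of_le_one_of_lt` (the `e^{5(r₁−κ)}` remark), `lemma3Numerics_of_conj`, ★ `chainNumerals_nonvacuous_allL (L ≥ 8) (M ≥ 1)` — via T52: ONE record `c` with
  `c.L = L`, `0 < c.κ`, `0 < c.ε₁`, the socket bundle at `M`, `0 ≤ C₃ε₁`, `hrate` for every `0 ≤ r₁ ≤ c.κ`, STRICT `hsmall` for every `r₁ < c.κ` and the exported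
  non-strict one at `r₁ = c.κ`, `hrenew` at every `E₀ ≥ c.E₀` (R23), with `0 ≤ c.E₀`.
* §5 END TO END AT THE WITNESS (the kernel check that §2's tuple IS the consumers' tuple): `hLayer_all_of_inductiveStepT_consts` (file 16's ★ with every numeric
  hypothesis discharged: (STEP-T) alone ⟹ the H-layer pair at every step) and `recAdmissible_of_stepGenT_consts` (file 18's ★: (GEN-T) alone ⟹ node00-def-W1's
  `RecAdmissible` for the class «(1.18)`(consts.E₀, consts.κ)` + analytic on the tables»), towers ∕ generators of ANY bond-cube side `M`, block factor `8`.

HONEST FRAMING.  A3 CONSISTENCY WITNESS for numerals AS TYPED (witness constants = the tree's `consts`, `L = 8`, `E₀ = 2`, rate `aw + 40M`; at `L > 8` T52's transferred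
record): they are NOT the record's constants and certify nothing about the size of Bałaban's constants or his regime; count-neutral; NOT a discharge of N18; NE5 NOT IN
PRINT ∕ NOT PROVED; one finite four-torus programme at fixed ε — NOT infinite volume, NOT OS on ℝ⁴, NOT a mass gap, NOT Clay.  0 `sorry`, 0 `def`, standard axioms.

References (TYPES only): [II] = [Balaban1988RG2Cluster] pp. 17–21 (restrictions on the constants; (2.31) p. 18; p. 20 before (2.37); R23 and the closing paragraph
p. 21); [I] = [Balaban1987RG1] p. 251 (block size), (1.18) p. 263; [KP86] = Kotecký–Preiss (the convergence condition of the NE1′ face that files 9 ∕ 10 read).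
-/

noncomputable section

namespace Summit.QuantumFields.YangMills.BalabanUVNodes.N18HLayerW1NumeralsStrict

open Literature.MathematicalPhysics.QuantumFieldTheory.Balaban1983to89
open Literature.MathematicalPhysics.QuantumFieldTheory.Balaban1983to89.B12TreeDecay (kappa₀ K₀ K₀_pos kappa₀_nonneg)
open Literature.MathematicalPhysics.QuantumFieldTheory.Balaban1983to89.B13Bound143 (invTau)
open Literature.MathematicalPhysics.QuantumFieldTheory.Balaban1983to89.B13Lemma3TorusSocket (Lemma3Numerics)
open Literature.MathematicalPhysics.QuantumFieldTheory.Balaban1983to89.B13Lemma3WindowNonvacuity (Kw κ₀w κw δw μw α₆w Aup A₁w A₂w ε₂w aw)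
open Literature.MathematicalPhysics.QuantumFieldTheory.Balaban1983to89.B13Lemma3TorusNonvacuity (κ₁t ε₁t consts numerics_nonvacuous_pos_consts consts_L)
open YMDAG.N22.W1 (lemma3Numerics_consts_anyM stripNumerics_consts)
open Summit.QuantumFields.BalabanUV.T4Continuum.Spine.NE5.TwoRunTorusNE5All8 (lemma3_witness_all8)
open Literature.MathematicalPhysics.QuantumFieldTheory.Balaban1983to89.T4Continuum (T4Family)
open Literature.MathematicalPhysics.QuantumFieldTheory.Balaban1983to89.TreeLengthTorus (TDom)
open Literature.MathematicalPhysics.QuantumFieldTheory.Balaban1983to89.B13Lemma3TorusData (TBond)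
open Literature.MathematicalPhysics.QuantumFieldTheory.Balaban1983to89.B13Lemma3TorusTerms (terms weight)
open Literature.MathematicalPhysics.QuantumFieldTheory.Balaban1983to89.Node00
open Literature.MathematicalPhysics.QuantumFieldTheory.Balaban1983to89.Node00.Sect2 (domSys domCount CPair)
open Literature.MathematicalPhysics.QuantumFieldTheory.Balaban1983to89.Node00.W1
open Summit.QuantumFields.YangMills.BalabanUVNodes.N18HLayerW1InductionTerms (hLayer_all_of_inductiveStepT)
open Summit.QuantumFields.YangMills.BalabanUVNodes.N18HLayerW1RecursionTerms (recAdmissible_of_stepGenT)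

/-! ## §1 The STRICT [KP86] clause at the tree's witness -/

/-- `1 ≤ K₀(64,8)`: `κ₀(64,8) = 64·log 162` (`TreeLengthCubeSystem.kappa₀_four`), so `K₀(64,8) = e^{64 log 162}∕(8+1)² = 162⁶⁴∕81 ≥ 1`. [folklore] -/
theorem one_le_Kw : 1 ≤ Kw := by
  have hκ₀ : kappa₀ 64 8 = 64 * Real.log 162 := by
    have h := TreeLengthCubeSystem.kappa₀_four
    norm_num at h
    exact h
  have hlog : Real.log ((162 : ℝ) ^ 64) = 64 * Real.log 162 := by
    rw [Real.log_pow]; norm_num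
  have hexp : Real.exp (kappa₀ 64 8) = (162 : ℝ) ^ 64 := by
    rw [hκ₀, ← hlog, Real.exp_log (by positivity)]
  show 1 ≤ K₀ 64 8
  unfold K₀
  rw [hexp, le_div_iff₀ (by positivity)]
  norm_num

/-- `0 < K₀(64,8)`, `0 < α₆w`, `0 < Aup`, `0 < A₁w`, `0 < A₂w`, `0 ≤ μw` — signs of the witness letters (public definitions of `B13Lemma3WindowNonvacuity`). [folklore] -/
theorem witness_signs : 0 < Kw ∧ 0 < α₆w ∧ 0 < Aup ∧ 0 < A₁w ∧ 0 < A₂w ∧ 0 ≤ μw := by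
  have hK : 0 < Kw := K₀_pos 64 8
  have hα : 0 < α₆w := by unfold α₆w; positivity
  have hAup : 0 < Aup := by unfold Aup; positivity
  have hA₁ : 0 < A₁w := by unfold A₁w; positivity
  have hA₂ : 0 < A₂w := by unfold A₂w; positivity
  have hκ₀ : 0 ≤ κ₀w := kappa₀_nonneg (by norm_num) 8
  have hκ : 0 ≤ κw := by unfold κw; positivity
  have hμ : 0 ≤ μw := by
    unfold μw δw
    have : (0 : ℝ) ≤ 1 - 7 * (3 / 40) := by norm_num
    positivity
  exact ⟨hK, hα, hAup, hA₁, hA₂, hμ⟩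

/-- `consts.eps2 = ε₂w`: the printed product `ε₂ = 2E₀ε₁C₁α₄⁻¹α₆⁻¹M^q e^{C₂κ₁}` (p. 19) at the witness letters `E₀ = 2`, `C₁ = α₄ = C₂ = 1`, `q = 0`, `α₆ = α₆w`,
`κ₁ = κ₁t`, `ε₁ = ε₁t = ε₂w·α₆w·e^{−κ₁t}∕4` (re-derivation of the witness file's private identity from public definitions).
[cite: Balaban1988RG2Cluster, p.19 (definition of ε₂)] -/
theorem eps2_consts_eq : consts.eps2 = ε₂w := by
  rw [B13.Consts.eps2_printed]
  show 2 * 2 * (ε₂w * α₆w * Real.exp (-κ₁t) / 4) * 1 * (1 : ℝ)⁻¹ * α₆w⁻¹ * (κw + 1) ^ 0 * Real.exp (1 * κ₁t) = ε₂w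
  have hα := ne_of_gt witness_signs.2.1
  rw [Real.exp_neg]
  field_simp
  ring

/-- `C₃ε₁ = 2(L+2)⁴·A₁·ε₂ = 2·10⁴·A₁w·ε₂w` at the witness (`B13.Consts.C3act_mul_eps1`, `L = 8`, `A₁ = A₁w`). [cite: Balaban1988RG2Cluster, p.20 (definition of C₃)] -/
theorem C3eps_consts_eq : consts.C3act * consts.ε₁ = 2 * 10000 * A₁w * ε₂w := by
  rw [B13.Consts.C3act_mul_eps1, eps2_consts_eq, consts_L]
  show 2 * (((8 : ℕ) : ℝ) + 2) ^ 4 * A₁w * ε₂w = 2 * 10000 * A₁w * ε₂w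
  norm_num

/-- **THE [KP86] PRODUCT AT THE WITNESS IN CLOSED FORM**: `C₃ε₁·e^{5κ+1}·K₀(64,8)·9·64 = α₆w·e^{−5μw}∕(Aup·A₂w)` — by the defining choice
`ε₂w = α₆w·e^{−(5κw+5μw+1)}∕(2·10⁴·Aup·A₁w·A₂w·K₀·576)` (the value given to ε₂ in the window ∕ torus witness). [cite: Balaban1988RG2Cluster, p.21 (closing paragraph: "The assumptions allow finally us to fix all the constants")] -/
theorem smallKP_consts_eq :
    consts.C3act * consts.ε₁ * Real.exp (5 * consts.κ + 1) * K₀ 64 8 * 9 * 64 = α₆w * Real.exp (-(5 * μw)) / (Aup * A₂w) := by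
  obtain ⟨hK, hα, hAup, hA₁, hA₂, -⟩ := witness_signs
  rw [C3eps_consts_eq]
  show 2 * 10000 * A₁w * ε₂w * Real.exp (5 * κw + 1) * Kw * 9 * 64 = α₆w * Real.exp (-(5 * μw)) / (Aup * A₂w)
  have hε : ε₂w * Real.exp (5 * κw + 1) = α₆w * Real.exp (-(5 * μw)) / (2 * 10000 * Aup * A₁w * A₂w * Kw * 576) := by
    unfold ε₂w
    rw [div_mul_eq_mul_div, mul_assoc α₆w, ← Real.exp_add]
    congr 2
    ring_nf
  have hK' : Kw ≠ 0 := ne_of_gt hK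
  have hA₁' : A₁w ≠ 0 := ne_of_gt hA₁
  calc 2 * 10000 * A₁w * ε₂w * Real.exp (5 * κw + 1) * Kw * 9 * 64
      = 2 * 10000 * A₁w * Kw * 576 * (ε₂w * Real.exp (5 * κw + 1)) := by ring
    _ = 2 * 10000 * A₁w * Kw * 576 * (α₆w * Real.exp (-(5 * μw)) / (2 * 10000 * Aup * A₁w * A₂w * Kw * 576)) := by rw [hε]
    _ = α₆w * Real.exp (-(5 * μw)) / (Aup * A₂w) := by field_simp

/-- `α₆w = (e·K₀(64,8)·64)⁻¹ < 1` (as `K₀(64,8) ≥ 1` and `e ≥ 2`). [folklore] -/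
theorem alpha6w_lt_one : α₆w < 1 := by
  have hK := one_le_Kw
  have he : (2 : ℝ) ≤ Real.exp 1 := by
    have h := Real.add_one_le_exp (1 : ℝ)
    linarith
  have hprod : (1 : ℝ) < Real.exp 1 * Kw * 64 := by nlinarith
  unfold α₆w
  exact inv_lt_one_of_one_lt₀ hprod

/-- **★ THE STRICT [KP86] CLAUSE AT THE WITNESS**: `consts.C3act·consts.ε₁·e^{5·consts.κ+1}·K₀(64,8)·9·64 < 1` — the STRICT form of conjunct 31 of
`numerics_nonvacuous_pos_consts` (there `≤ 1`), which the any-table (1.18) producers of files 10 ∕ 12 ∕ 15–18 read as `hsmall` at `A := C₃ε₁`, `r₁ := κ`.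
At the witness the product equals `α₆w·e^{−5μw}∕(Aup·A₂w) ≤ α₆w < 1`. [cite: Balaban1988RG2Cluster, p.20 (before (2.37)) and p.21 (closing paragraph)] -/
theorem smallKP_consts_strict : consts.C3act * consts.ε₁ * Real.exp (5 * consts.κ + 1) * K₀ 64 8 * 9 * 64 < 1 := by
  obtain ⟨hK, hα, hAup, hA₁, hA₂, hμ⟩ := witness_signs
  rw [smallKP_consts_eq]
  have hAup1 : 1 ≤ Aup := by
    unfold Aup
    have h1 : (1 : ℝ) ≤ Real.exp 64 := Real.one_le_exp (by norm_num)
    nlinarith [one_le_Kw]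
  have hA₂1 : 1 ≤ A₂w := by
    unfold A₂w
    have h1 : (1 : ℝ) ≤ Real.exp 1 := Real.one_le_exp (by norm_num)
    have h2 : (1 : ℝ) ≤ Kw ^ 2 := by nlinarith [one_le_Kw]
    nlinarith
  have hden : 1 ≤ Aup * A₂w := by nlinarith
  have hexp : Real.exp (-(5 * μw)) ≤ 1 := by
    rw [Real.exp_le_one_iff]; linarith
  calc α₆w * Real.exp (-(5 * μw)) / (Aup * A₂w) ≤ α₆w * 1 / 1 := by
        gcongr
    _ = α₆w := by ring
    _ < 1 := alpha6w_lt_one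

/-! ## §2 The numeric hypothesis tuple of files 16 ∕ 18 at the witness, every bond-cube side `M` -/

/-- **★ THE NUMERALS OF THE (STEP-T) ∕ (GEN-T) CHAIN HOLD AT THE WITNESS FOR EVERY BOND-CUBE SIDE `M`.**  At `c := consts` (L = 8, δ = 3∕40, E₀ = 2), transfer
factor `½L`, rate `aw + 40M`, socket letters `(a₂, a₂′, a₅, Aabs) := (1, 1, ½, 1)`, (1.18)-rate `r₁ := consts.κ` and amplitude `E₀ := consts.E₀`: `8 ≤ c.L`, `c.L = 8`,
the socket bundle `Lemma3Numerics c M (½c.L) …` (dag-n22-c's `lemma3Numerics_consts_anyM`), `0 ≤ κ`, `0 ≤ C₃ε₁`, the located rate clause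
`κ + 2·64·log 162 + 2 ≤ (1−8δ)·½L·κ`, the STRICT [KP86] clause (§1), the renewal `e·9·64·K₀(64,8)²·C₃ε₁ ≤ E₀` (R23) and `0 < E₀` — i.e. every numeric hypothesis
(`hL`, `hLc`, `hN`, `hr₁`, `hA`, `hrate`, `hsmall`, `hrenew`) of `…N18HLayerW1InductionTerms` ∕ `…N18HLayerW1RecursionTerms` (hence of files 10 ∕ 12 ∕ 15 ∕ 17 at
`A := C₃ε₁`, `R := (1−8δ)·½L·κ`) simultaneously, at every `M : ℕ`.  Consistency of the typed clause list; nothing about Bałaban's regime.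
[cite: Balaban1988RG2Cluster, pp.17-21 (restrictions on the constants), (2.31) p.18, p.21 (R23 and the closing paragraph); Balaban1987RG1, (1.18) p.263] -/
theorem chainNumerals_consts_anyM (M : ℕ) :
    8 ≤ consts.L ∧ consts.L = 8 ∧ Lemma3Numerics consts M ((consts.L : ℝ) / 2) (aw + 40 * (M : ℝ)) 1 1 (1 / 2) 1 ∧ 0 ≤ consts.κ ∧
      0 ≤ consts.C3act * consts.ε₁ ∧
      consts.κ + 2 * (64 * Real.log 162) + 2 ≤ (1 - 8 * consts.δ) * ((consts.L : ℝ) / 2) * consts.κ ∧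
      consts.C3act * consts.ε₁ * Real.exp (5 * consts.κ + 1) * K₀ 64 8 * 9 * 64 < 1 ∧
      Real.exp 1 * 9 * 64 * K₀ 64 8 ^ 2 * (consts.C3act * consts.ε₁) ≤ consts.E₀ ∧ 0 < consts.E₀ := by
  obtain ⟨hL, -, hC3pos, hκ, -, hlarge, -, hrenew⟩ := stripNumerics_consts
  have hE₀ : (0 : ℝ) < consts.E₀ := by show (0 : ℝ) < 2; norm_num
  exact ⟨hL, consts_L, lemma3Numerics_consts_anyM M, hκ, hC3pos, hlarge, smallKP_consts_strict, hrenew, hE₀⟩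

/-! ## §3 The `∃`-packaging at every `M` -/

/-- **THE NUMERIC HYPOTHESES OF FILES 16 ∕ 18 ARE JOINTLY SATISFIABLE AT EVERY BOND-CUBE SIDE `M`** — in their binder order: constants `c`, block factor `L` with
`8 ≤ c.L`, `c.L = L`, socket letters `(a, a₂, a₂′, a₅, Aabs)` with `Lemma3Numerics c M (½c.L) …`, (1.18)-letters `(E₀, r₁)` with `0 ≤ r₁`, `0 ≤ C₃ε₁`, the located rate
clause, the STRICT [KP86] clause, the renewal, `0 < E₀`; the witness reads `r₁ = c.κ` (print's identification of the (1.18) rate with κ) and `E₀ = c.E₀` (displayed).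
[cite: Balaban1988RG2Cluster, p.21 (closing paragraph); Balaban1987RG1, (1.18) p.263] -/
theorem chainNumerals_nonvacuous_anyM (M : ℕ) :
    ∃ (c : B13.Consts) (L : ℕ) (a a₂ a₂' a₅ Aabs E₀ r₁ : ℝ), 8 ≤ c.L ∧ c.L = L ∧
      Lemma3Numerics c M ((c.L : ℝ) / 2) a a₂ a₂' a₅ Aabs ∧ 0 ≤ r₁ ∧ 0 ≤ c.C3act * c.ε₁ ∧
      r₁ + 2 * (64 * Real.log 162) + 2 ≤ (1 - 8 * c.δ) * ((c.L : ℝ) / 2) * c.κ ∧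
      c.C3act * c.ε₁ * Real.exp (5 * r₁ + 1) * K₀ 64 8 * 9 * 64 < 1 ∧
      Real.exp 1 * 9 * 64 * K₀ 64 8 ^ 2 * (c.C3act * c.ε₁) ≤ E₀ ∧ 0 < E₀ ∧ r₁ = c.κ ∧ E₀ = c.E₀ := by
  obtain ⟨hL, hL8, hN, hκ, hC3pos, hlarge, hsmall, hrenew, hE₀⟩ := chainNumerals_consts_anyM M
  exact ⟨consts, 8, aw + 40 * (M : ℝ), 1, 1, 1 / 2, 1, consts.E₀, consts.κ, hL, hL8, hN, hκ, hC3pos, hlarge, hsmall, hrenew, hE₀, rfl, rfl⟩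

/-! ## §4 Every block size `L ≥ 8` (print's `L` odd `> 11`), every bond-cube side `M ≥ 1` -/

/-- **STRICTNESS BELOW THE RATE FROM THE EXPORTED NON-STRICT CLAUSE**: if `A·e^{5κ+1}·K₀(64,8)·9·64 ≤ 1` and `0 ≤ A`, then for every `r₁ < κ`,
`A·e^{5r₁+1}·K₀(64,8)·9·64 < 1` (the product is the one at `κ` times `e^{5(r₁−κ)} < 1`). [folklore] -/
theorem strictKP_of_le_one_of_lt {A κ r₁ : ℝ} (hA : 0 ≤ A) (hle : A * Real.exp (5 * κ + 1) * K₀ 64 8 * 9 * 64 ≤ 1) (hr : r₁ < κ) :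
    A * Real.exp (5 * r₁ + 1) * K₀ 64 8 * 9 * 64 < 1 := by
  have hK := K₀_pos 64 8
  have hsplit : Real.exp (5 * r₁ + 1) = Real.exp (5 * κ + 1) * Real.exp (5 * (r₁ - κ)) := by
    rw [← Real.exp_add]; ring_nf
  have hlt : Real.exp (5 * (r₁ - κ)) < 1 := by
    rw [Real.exp_lt_one_iff]; linarith
  have h0 : 0 ≤ A * Real.exp (5 * κ + 1) * K₀ 64 8 * 9 * 64 := by positivity
  calc A * Real.exp (5 * r₁ + 1) * K₀ 64 8 * 9 * 64
      = (A * Real.exp (5 * κ + 1) * K₀ 64 8 * 9 * 64) * Real.exp (5 * (r₁ - κ)) := by rw [hsplit]; ring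
    _ ≤ 1 * Real.exp (5 * (r₁ - κ)) := mul_le_mul_of_nonneg_right hle (Real.exp_pos _).le
    _ < 1 := by rw [one_mul]; exact hlt

/-- **THE SOCKET BUNDLE FROM THE 41 CONJUNCTS** (the 25 fields of `Lemma3Numerics c M (½c.L) a a₂ a₂′ a₅ Aabs` read off the printed ∕ located list of
`numerics_nonvacuous_pos`, for ANY record — `B13NodeTorusFamilyNonvacuity.numerics_consts` is this at the named witness), together with the clauses the chain reads
besides it: `0 ≤ C₃ε₁`, the located rate clause at `r₁ := κ`, the non-strict [KP86] clause at `κ`, R23's renewal at `E₀ := c.E₀`, and the signs `0 < κ`, `0 < ε₁`, `0 ≤ E₀`.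
[cite: Balaban1988RG2Cluster, pp.17-21 (restrictions on the constants), p.21 (R23 and the closing paragraph)] -/
theorem lemma3Numerics_of_conj (c : B13.Consts) {M : ℕ} {a a₂ a₂' a₅ Aabs Bc : ℝ}
    (h : 8 ≤ c.L ∧ 0 < M ∧ 0 < c.ε₁ ∧ 0 < c.α₆ ∧ 0 ≤ c.eps2 ∧ 0 ≤ c.δ ∧ 0 ≤ 1 - 7 * c.δ ∧ 0 ≤ c.κ ∧ 0 ≤ a ∧
      c.R15 ∧ 18 * ((1 - 4 * c.δ) * c.κ) ≤ a / 20 ∧ 4 * c.κ ≤ a / 20 ∧ Real.exp (-(a / 20)) ≤ c.eps2 ∧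
      2 * (4 : ℝ) * (M : ℝ) ^ 4 * Real.exp (-(a / 10)) ≤ a / 20 ∧
      0 ≤ a₂ ∧ kappa₀ 64 8 + a₂ ≤ c.δ * c.κ ∧ c.α₆ * Real.exp a₂ * K₀ 64 8 * 64 ≤ a₂ ∧
      Real.exp (-(a / 20)) * 64 ≤ c.δ * c.κ ∧
      B13Step237.R18half c (K₀ 64 8 * Real.exp (Real.exp (-(a / 20)) * 64)) ∧
      B13Step237.R18sharp c (K₀ 64 8 * Real.exp (Real.exp (-(a / 20)) * 64)) ((c.L : ℝ) / 2) ∧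
      0 ≤ a₂' ∧ kappa₀ 64 8 + a₂' ≤ c.δ * ((c.L : ℝ) / 2) * c.κ ∧ c.α₆ * Real.exp a₂' * K₀ 64 8 * 64 ≤ a₂' ∧
      18 * ((1 - 7 * c.δ) * ((c.L : ℝ) / 2) * c.κ) ≤ (c.κ₁ - 1) / 2 ∧
      0 ≤ a₅ ∧ a₅ + Real.exp (-((c.κ₁ - 1) / 2)) ≤ Aabs ∧ Aabs * 64 ≤ c.δ * ((c.L : ℝ) / 2) * c.κ ∧
      B13Step237.bracketF c (K₀ 64 8 * Real.exp (Real.exp (-(a / 20)) * 64)) / c.α₆ * Real.exp (Aabs * 64) ≤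
        c.C3act * c.ε₁ ∧
      0 ≤ c.C3act * c.ε₁ ∧ c.κ + 2 * (64 * Real.log 162) + 2 ≤ (1 - 8 * c.δ) * ((c.L : ℝ) / 2) * c.κ ∧
      c.C3act * c.ε₁ * Real.exp (5 * c.κ + 1) * K₀ 64 8 * 9 * 64 ≤ 1 ∧
      Real.exp 1 * 9 * 64 * K₀ 64 8 ^ 2 ≤ c.A₂ ∧ c.R22 ∧ c.R23 ∧ c.R24sharp ∧ 0 ≤ c.E₀ ∧
      0 ≤ Bc ∧ Bc * 64 ≤ c.E₀ / 2 ∧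
      0 < a₅ ∧ 1 ≤ c.κ₁ ∧
      (∀ d : ℝ, 0 ≤ d → 0 < invTau c d ∧ invTau c d ≤ 1 / 2)) :
    Lemma3Numerics c M ((c.L : ℝ) / 2) a a₂ a₂' a₅ Aabs ∧ 0 ≤ c.C3act * c.ε₁ ∧
      c.κ + 2 * (64 * Real.log 162) + 2 ≤ (1 - 8 * c.δ) * ((c.L : ℝ) / 2) * c.κ ∧
      c.C3act * c.ε₁ * Real.exp (5 * c.κ + 1) * K₀ 64 8 * 9 * 64 ≤ 1 ∧
      Real.exp 1 * 9 * 64 * K₀ 64 8 ^ 2 * (c.C3act * c.ε₁) ≤ c.E₀ ∧ 0 < c.κ ∧ 0 < c.ε₁ ∧ 0 ≤ c.E₀ := by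
  obtain ⟨-, -, hε₁, hα₆, heps2, hδ, hδ7, hκ, ha, hR15, hR16, hR16', hR17, h231, ha₂, hκ229, hsm229, habsk, h18half, h18, ha₂', hκ229', hsm229',
    hR20, ha₅, habs, hAc, hC3, hC3pos, hlarge, hsmall, hA₂, -, hR23, -, hE₀, -, -, -, -, -⟩ := h
  have hℓ : (0 : ℝ) ≤ (c.L : ℝ) / 2 := by positivity
  have hN : Lemma3Numerics c M ((c.L : ℝ) / 2) a a₂ a₂' a₅ Aabs :=
    ⟨hℓ, hα₆, heps2, hδ, hδ7, hκ, ha, hR15, hR16, hR16', hR17, h231, ha₂, hκ229, hsm229, habsk, h18half, h18, ha₂', hκ229', hsm229', hR20, ha₅, habs,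
      hAc, hC3⟩
  -- the renewal from R23: e·9·64·K₀² ≤ A₂ and A₂·C₃ε₁ ≤ ½E₀ ≤ E₀
  have h23 : c.A₂ * c.C3act * c.ε₁ ≤ c.E₀ / 2 := hR23
  have hrenew : Real.exp 1 * 9 * 64 * K₀ 64 8 ^ 2 * (c.C3act * c.ε₁) ≤ c.E₀ := by
    calc Real.exp 1 * 9 * 64 * K₀ 64 8 ^ 2 * (c.C3act * c.ε₁)
        ≤ c.A₂ * (c.C3act * c.ε₁) := mul_le_mul_of_nonneg_right hA₂ hC3pos
      _ = c.A₂ * c.C3act * c.ε₁ := by ring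
      _ ≤ c.E₀ := by linarith
  -- the rate is positive: κ₀(64,8) = 64 log 162 > 0 and κ₀ + a₂ ≤ δκ with a₂, δ, κ ≥ 0
  have hκ₀pos : 0 < kappa₀ 64 8 := by
    have h4 := TreeLengthCubeSystem.kappa₀_four
    norm_num at h4
    rw [h4]
    have : 0 < Real.log 162 := Real.log_pos (by norm_num)
    positivity
  have hκpos : 0 < c.κ := by
    rcases hκ.lt_or_eq with hlt | heq
    · exact hlt
    · exfalso
      have : c.δ * c.κ = 0 := by rw [← heq, mul_zero]
      linarith
  exact ⟨hN, hC3pos, hlarge, hsmall, hrenew, hκpos, hε₁, hE₀⟩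

/-- **★ THE NUMERIC HYPOTHESES OF THE (STEP-T) ∕ (GEN-T) CHAIN ARE JOINTLY SATISFIABLE AT EVERY BLOCK SIZE `L ≥ 8` AND EVERY BOND-CUBE SIDE `M ≥ 1`.**  For every
`L ≥ 8` and `M ≥ 1` there are constants `c` WITH `c.L = L` (print: *"L is an odd, positive integer > 11"*, [I] p. 251 — every such `L` is served; T52
`lemma3_witness_all8`'s transferred record) and socket letters such that: `0 < c.κ`, `0 < c.ε₁`, `0 ≤ c.E₀`, the socket bundle `Lemma3Numerics c M (½c.L) a a₂ a₂′ a₅ Aabs`,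
`0 ≤ C₃ε₁`, the located rate clause for EVERY (1.18)-rate `r₁ ≤ c.κ`, the STRICT [KP86] clause for every `r₁ < c.κ` (§4's `e^{5(r₁−κ)}` remark) and the exported
non-strict one at `r₁ = c.κ`, and the renewal for every amplitude `E₀ ≥ c.E₀` (R23: `A₂C₃ε₁ ≤ ½E₀`, `e·9·64·K₀² ≤ A₂`).  Consistency of the typed clause list of
files 10 ∕ 12 ∕ 15–18 (and of the strip modules ∕ N10's family, which read the non-strict clause) at the record's block size and bond-cube side, AS LETTERS — the
witness constants are not the record's constants. [cite: Balaban1987RG1, p.251 and (1.18) p.263; Balaban1988RG2Cluster, pp.17-21, (2.31) p.18, p.21 (R23 and the closing paragraph)] -/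
theorem chainNumerals_nonvacuous_allL (L : ℕ) (hL : 8 ≤ L) (M : ℕ) (hM : 1 ≤ M) :
    ∃ (c : B13.Consts) (a a₂ a₂' a₅ Aabs : ℝ), c.L = L ∧ 0 < c.κ ∧ 0 < c.ε₁ ∧ 0 ≤ c.E₀ ∧
      Lemma3Numerics c M ((c.L : ℝ) / 2) a a₂ a₂' a₅ Aabs ∧ 0 ≤ c.C3act * c.ε₁ ∧
      (∀ r₁ : ℝ, r₁ ≤ c.κ → r₁ + 2 * (64 * Real.log 162) + 2 ≤ (1 - 8 * c.δ) * ((c.L : ℝ) / 2) * c.κ) ∧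
      (∀ r₁ : ℝ, r₁ < c.κ → c.C3act * c.ε₁ * Real.exp (5 * r₁ + 1) * K₀ 64 8 * 9 * 64 < 1) ∧
      c.C3act * c.ε₁ * Real.exp (5 * c.κ + 1) * K₀ 64 8 * 9 * 64 ≤ 1 ∧
      (∀ E₀ : ℝ, c.E₀ ≤ E₀ → Real.exp 1 * 9 * 64 * K₀ 64 8 ^ 2 * (c.C3act * c.ε₁) ≤ E₀) := by
  obtain ⟨a₂, a₂', a₅, Aabs, Bc, hall⟩ := lemma3_witness_all8
  obtain ⟨c, hcL, hallM⟩ := hall L hL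
  obtain ⟨a, h⟩ := hallM M hM
  obtain ⟨hN, hC3pos, hlarge, hsmall, hrenew, hκpos, hε₁, hE₀⟩ := lemma3Numerics_of_conj c h
  refine ⟨c, a, a₂, a₂', a₅, Aabs, hcL, hκpos, hε₁, hE₀, hN, hC3pos, fun r₁ hr => by linarith, fun r₁ hr => strictKP_of_le_one_of_lt hC3pos hsmall hr,
    hsmall, fun E₀ hE => hrenew.trans hE⟩

/-! ## §5 End to end at the witness: the consumers with every numeric hypothesis discharged -/

section EndToEnd

variable (F : T4Family) (K : ℕ) {𝔸 : Type} [NormedRing 𝔸] [NormedAlgebra ℂ 𝔸] {M : ℕ} [NeZero M]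

open Classical in
/-- **FILE 16's ★ AT THE WITNESS — (STEP-T) ALONE ⟹ THE H-LAYER PAIR AT EVERY STEP.**  `hLayer_all_of_inductiveStepT` with constants `consts`, block factor `8`,
rate `aw + 40M`, socket letters `(1, 1, ½, 1)`, (1.18)-letters `(E₀, r₁) := (consts.E₀, consts.κ)`: every numeric hypothesis (`hL`, `hLc`, `hN`, `hr₁`, `hA`, `hrate`,
STRICT `hsmall`, `hrenew`) is discharged by §2, for towers of ANY bond-cube side `M`; what remains displayed is the level-T schema (N10's Lemmas 1–2 ∕ NODE A for
the terms of record, conditional on [I]'s inductive assumptions), the window law `hW` and the tables' restriction property.  The activities come out analytic and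
(2.38)-bounded with `A = C₃ε₁`, `R = (1−8δ)·½L·κ` at the witness letters. [cite: Balaban1988RG2Cluster, (2.14) p.15, (2.26) p.17, Lemma 3 (2.38) p.20, p.21 (closing paragraph); Balaban1987RG1, Thm 1 p.259] -/
theorem hLayer_all_of_inductiveStepT_consts (S : ClusterTower (F.P K) 𝔸 M) (W : Set (ℕ → ℝ)) (Wk : (k : ℕ) → Set (Fin (k + 1) → ℝ))
    (sp : (j : ℕ) → (domSys (F.P K) M j).Dom → Set (CPair (F.P K) 𝔸))
    (T : (k : ℕ) → (Fin (k + 1) → ℝ) → (Z : TDom 4 (domCount (F.P K) M (k + 1))) →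
      Finset (TDom 4 (8 * domCount (F.P K) M (k + 1))) × Finset (TBond 4 M (8 * domCount (F.P K) M (k + 1))) → CPair (F.P K) 𝔸 → ℂ)
    (hW : ∀ k, ∀ g ∈ W, restrictPrefix k g ∈ Wk k) (hrestr : ∀ k, W1.SpRestr (sp (k + 1)))
    (hstepT : ∀ k : ℕ,
      (∀ g ∈ W, ∀ j ≤ k, ∀ (X : (domSys (F.P K) M j).Dom), ∀ φ ∈ sp j X,
          ‖termC S j X g φ‖ ≤ consts.E₀ * Real.exp (-(consts.κ * (domSys (F.P K) M j).dj X))) →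
      (∀ g ∈ W, ∀ j ≤ k, ∀ (X : (domSys (F.P K) M j).Dom), AnalyticOnNhd ℂ (termC S j X g) (sp j X)) →
      (S k).AnalyticT (Wk k) (sp (k + 1)) ∧
      (∀ g ∈ Wk k, ∀ (Z : (domSys (F.P K) M (k + 1)).Dom) (φ : CPair (F.P K) 𝔸), φ ∈ sp (k + 1) Z →
          ‖(S k).H g φ Z‖ ≤ ∑ t ∈ terms 8 M Z, ‖T k g Z t φ‖) ∧
      (∀ g ∈ Wk k, ∀ (Z : (domSys (F.P K) M (k + 1)).Dom) (φ : CPair (F.P K) 𝔸), φ ∈ sp (k + 1) Z → ∀ t ∈ terms 8 M Z,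
          ‖T k g Z t φ‖ ≤ weight 8 M consts Z (aw + 40 * (M : ℝ)) t * Real.exp (1 / 2 * ((Z.1).card : ℝ)))) :
    ∀ k, (S k).AnalyticH (Wk k) (sp (k + 1)) ∧
      (S k).Bound238 (Wk k) (sp (k + 1)) (consts.C3act * consts.ε₁) ((1 - 8 * consts.δ) * ((consts.L : ℝ) / 2) * consts.κ) := by
  obtain ⟨hL, hL8, hN, hκ, hC3pos, hlarge, hsmall, hrenew, -⟩ := chainNumerals_consts_anyM M
  exact hLayer_all_of_inductiveStepT F K S W Wk sp consts hL hL8 hN T hW hrestr hstepT hκ hC3pos hlarge hsmall hrenew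

open Classical in
/-- **FILE 18's ★ AT THE WITNESS — (GEN-T) ALONE ⟹ node00-def-W1's `RecAdmissible`.**  `recAdmissible_of_stepGenT` with constants `consts`, block factor `8`, rate
`aw + 40M`, socket letters `(1, 1, ½, 1)`, (1.18)-letters `(consts.E₀, consts.κ)`: every numeric hypothesis discharged by §2, for generator towers of ANY bond-cube side
`M`; displayed remain the per-generator schema (GEN-T) (N10's Lemmas 1–2 ∕ NODE A for the generator of record) and the tables' restriction property.  Conclusion: the
class «(1.18)`(consts.E₀, consts.κ)` on the tables + analytic there» is `RecAdmissible` for the generated recursion. [cite: Balaban1987RG1, §1 p.263 (the inductive assumptions) and Thm 1 p.259; Balaban1988RG2Cluster, (2.14) p.15, (2.26) p.17, p.21 (closing paragraph) and p.22] -/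
theorem recAdmissible_of_stepGenT_consts (G : GenTower (F.P K) 𝔸 M) (D : Set ℂ)
    (sp : (j : ℕ) → (domSys (F.P K) M j).Dom → Set (CPair (F.P K) 𝔸)) (hrestr : ∀ k, W1.SpRestr (sp (k + 1)))
    (Tm : (k : ℕ) → ℂ → OlderTerms (F.P K) 𝔸 M k → (Z : TDom 4 (domCount (F.P K) M (k + 1))) →
      Finset (TDom 4 (8 * domCount (F.P K) M (k + 1))) × Finset (TBond 4 M (8 * domCount (F.P K) M (k + 1))) → CPair (F.P K) 𝔸 → ℂ)
    (hgenT : ∀ k : ℕ, ∀ t ∈ D, ∀ old : OlderTerms (F.P K) 𝔸 M k,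
      (∀ (j : Fin (k + 1)) (Y : (domSys (F.P K) M j).Dom), ∀ ψ ∈ sp j Y,
          ‖old j Y ψ‖ ≤ consts.E₀ * Real.exp (-(consts.κ * (domSys (F.P K) M j).dj Y))) →
      (∀ (j : Fin (k + 1)) (Y : (domSys (F.P K) M j).Dom), AnalyticOnNhd ℂ (old j Y) (sp j Y)) →
      (∀ (Z : (domSys (F.P K) M (k + 1)).Dom), ∀ i ∈ (G k).idx Z, AnalyticOnNhd ℂ (fun φ => (G k).T i t old φ) (sp (k + 1) Z)) ∧
      (∀ (Z : (domSys (F.P K) M (k + 1)).Dom) (φ : CPair (F.P K) 𝔸), φ ∈ sp (k + 1) Z →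
          ‖(G k).H t old φ Z‖ ≤ ∑ τ ∈ terms 8 M Z, ‖Tm k t old Z τ φ‖) ∧
      (∀ (Z : (domSys (F.P K) M (k + 1)).Dom) (φ : CPair (F.P K) 𝔸), φ ∈ sp (k + 1) Z → ∀ τ ∈ terms 8 M Z,
          ‖Tm k t old Z τ φ‖ ≤ weight 8 M consts Z (aw + 40 * (M : ℝ)) τ * Real.exp (1 / 2 * ((Z.1).card : ℝ)))) :
    RecAdmissible G D fun k => {old : OlderTerms (F.P K) 𝔸 M k |
      (∀ (j : Fin (k + 1)) (Y : (domSys (F.P K) M j).Dom), ∀ ψ ∈ sp j Y,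
          ‖old j Y ψ‖ ≤ consts.E₀ * Real.exp (-(consts.κ * (domSys (F.P K) M j).dj Y))) ∧
      (∀ (j : Fin (k + 1)) (Y : (domSys (F.P K) M j).Dom), AnalyticOnNhd ℂ (old j Y) (sp j Y))} := by
  obtain ⟨hL, hL8, hN, hκ, hC3pos, hlarge, hsmall, hrenew, -⟩ := chainNumerals_consts_anyM M
  exact recAdmissible_of_stepGenT F K G D sp hrestr consts hL hL8 hN Tm hgenT hκ hC3pos hlarge hsmall hrenew

end EndToEnd

end Summit.QuantumFields.YangMills.BalabanUVNodes.N18HLayerW1NumeralsStrict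

end
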